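import Summits.ResolutionOfSingularities.ResolutionOfSingularities.Theorems.LossEntryW25
import Summits.ResolutionOfSingularities.ResolutionOfSingularities.Theorems.ConeCutRepeats
import HarnessLib

/-!
# LossEntryW27 — decomp-res lens-3 g29 «LossEntryWalk», landing part 27 (slice 19): the wall-state pencil law for an
α-STEP (move in the chart of the wall letter) and frame re-orientation

Residual `stmt-ResolutionOfSingularities-27367`.  Imports part 25 (+ tree `ConeCutRepeats` for
`ConeCut.coeff_translate_top`); independent of parts 12–24 and of part 26.

* `resForm_eq_pure_of_wall_pure_alpha` — one-wall state `u` (boundary `M·e_a`, shade `s`, order `s+M > q`), move in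
  the chart `a` of the WALL LETTER, shade plateau, in-wall slice of the lowest layer `= φ₀·(u_c − μ u_b)^s`
  ⟹ `resForm W u (s+M) = C φ₀ · (u_c − μ u_b)^s` (the residual form is a form of degree `s` by `cone_of_plateau`, and
  its top coefficients are those of the `u_a`-dehomogenised layer, i.e. the in-wall slice);
* `wall_pure_succ_alpha` — hence (`restriction_of_plateau`) the next state's in-wall slice (wall again `u_a`) is pure
  with the SAME root `μ`: an α-step keeps the pencil member (the step law (S1) of NODE-g29 uses the same parameter on
  both sides — this is why);
* `pure_pow_reorient` — `C φ·(u_c − κ u_a)^s = C (φ(−κ)^s)·(u_a − κ⁻¹ u_c)^s` (`κ ≠ 0`), the bookkeeping identity that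
  reads a propagated root in the frame of the next chart.

Tree tools only; complete proofs, standard axioms.

(Sources: Hauser2010 §F; HauserPerlega2019 §2; CossartJannsenSaito2020 Ch. 8; Moh1987; Perlega2022.)
-/

open MvPolynomial Finset
open Literature.AlgebraicGeometry.Resolution
open Literature.AlgebraicGeometry.Resolution.Hauser2010
open Literature.AlgebraicGeometry.Resolution.PointBlowup
open Summit.ResolutionOfSingularities.ResolutionOfSingularities.Theorems.TightDefectClasses
open Summit.ResolutionOfSingularities.ResolutionOfSingularities.Theorems.TightDefectStrongWalks
open Summit.ResolutionOfSingularities.ResolutionOfSingularities.Theorems.ItineraryCutClasses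
open Summit.ResolutionOfSingularities.ResolutionOfSingularities.Theorems.BoundaryLedger
open Summit.ResolutionOfSingularities.ResolutionOfSingularities.Theorems.ProximityCut
open Summit.ResolutionOfSingularities.ResolutionOfSingularities.Theorems.ConeCut
open Summit.ResolutionOfSingularities.ResolutionOfSingularities.Theorems.LossExitCone

namespace Summit.ResolutionOfSingularities.ResolutionOfSingularities.Theorems.LossPolygon

section WallAlphaStep

variable {K : Type} [Field K] [DecidableEq K] {q : ℕ} {s₀ : State (Fin 3) K}

/-- **WALL-STATE PENCIL LAW, α-STEP — residual form (PROVED).**  At a one-wall state `u` (boundary `M·e_a`, shade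
`s`, order `s + M > q`) moving in the chart of the WALL LETTER `a` with a shade plateau: if the in-wall slice of the
lowest layer is the pure power `φ₀·(u_c − μ u_b)^s` then the residual form of the move is `C φ₀ · (u_c − μ u_b)^s` —
the same pencil member, untouched by the translation `(b_u(b), b_u(c))`: the lowest layer of `F_u` is
`φ₀·u_a^M·(u_c − μ u_b − (b_u(c) − μ b_u(b))·u_a)^s`.  (The residual form is a form of degree `s` by `cone_of_plateau`;
its top coefficients are those of the `u_a`-dehomogenised layer, i.e. the in-wall slice.) [new] [folklore] -/
theorem resForm_eq_pure_of_wall_pure_alpha (hroot : IsRoot q s₀) (W : ForcedWalk q s₀) (u : ℕ) {a b c : Fin 3}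
    (hab : a ≠ b) (hac : a ≠ c) (hj : W.j u = a) {M s : ℕ}
    (hr : (W.st u).r = Finsupp.single a M) (hsh : (W.st u).shade = (s : ℕ∞))
    (hplat : (W.st (u + 1)).shade = (W.st u).shade) (hq : q < s + M) {φ₀ μ : K}
    (hwall : ∀ E : Fin 3 →₀ ℕ, E.degree = s → E a = 0 →
      coeff ((W.st u).r + E) (W.st u).F = φ₀ * coeff E ((X c - C μ * X b) ^ s)) :
    ordZero (W.st u).F = ((s + M : ℕ) : ℕ∞) ∧ resForm W u (s + M) = C φ₀ * (X c - C μ * X b) ^ s := by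
  classical
  obtain ⟨o, ho, -⟩ := walk_nat hroot W u
  obtain ⟨n, hn, hon⟩ := order_eq_shade_add_degree hroot W u ho
  have hns : n = s := by
    have h := hsh
    rw [hn] at h
    exact_mod_cast h
  subst hns
  have hrdeg : (W.st u).r.degree = M := by rw [hr, Finsupp.degree_single]
  rw [hrdeg] at hon
  subst hon
  refine ⟨ho, ?_⟩
  have hqo : q < n + M := hq
  have hcone := (cone_of_plateau hroot W u ho hqo hplat hn).1
  set Q : MvPolynomial (Fin 3) K := C φ₀ * (X c - C μ * X b) ^ n with hQ
  have hQhom : Q.IsHomogeneous n := by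
    have h1 : (X c - C μ * X b : MvPolynomial (Fin 3) K).IsHomogeneous 1 :=
      (isHomogeneous_X K c).sub (by simpa using (isHomogeneous_C (Fin 3) μ).mul (isHomogeneous_X K b))
    simpa [hQ] using (isHomogeneous_C (Fin 3) φ₀).mul (h1.pow n)
  have hDhom : (resForm W u (n + M) - Q).IsHomogeneous n := hcone.sub hQhom
  -- every coefficient of the difference vanishes
  rw [← sub_eq_zero]
  ext E
  rw [coeff_zero]
  by_cases hEdeg : E.degree = n
  swap
  · exact hDhom.coeff_eq_zero hEdeg
  by_cases hEa : E a = 0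
  swap
  · rw [coeff_sub, coeff_resForm_eq_zero W u _ (by rw [hj]; exact hEa), hQ, coeff_C_mul,
      coeff_pure_pow_eq_zero (Ne.symm hab) hac μ n E hEa, mul_zero, sub_zero]
  -- top coefficients are preserved by the (un)translation
  have htop : coeff E (translate (-W.b u) (resForm W u (n + M) - Q)) = coeff E (resForm W u (n + M) - Q) :=
    coeff_translate_top _ _ fun d hd => by
      rw [hEdeg]
      by_contra h
      exact (MvPolynomial.mem_support_iff.mp hd) (hDhom.coeff_eq_zero fun h' => h h'.le)
  have hQtop : coeff E (translate (-W.b u) Q) = coeff E Q :=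
    coeff_translate_top _ _ fun d hd => by
      rw [hEdeg]
      by_contra h
      exact (MvPolynomial.mem_support_iff.mp hd) (hQhom.coeff_eq_zero fun h' => h h'.le)
  have hL : translate (-W.b u) (resForm W u (n + M)) = resLayer (W.j u) (W.st u) (n + M) := by
    unfold resForm
    rw [LossExitCone.translate_translate, neg_add_cancel, PointBlowup.translate_zero]
  have hupd : E.update a 0 = E := by
    ext w
    rw [Finsupp.update_apply]
    by_cases hwa : w = a
    · rw [if_pos hwa, hwa, hEa]
    · rw [if_neg hwa]
  rw [← htop, translate_sub, coeff_sub, hL, hQtop, hj, ← hupd,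
    coeff_resLayer a (W.st u) (walk_r hroot W u) (n + M) E (by rw [hEdeg, hrdeg]), hwall E hEdeg hEa, hupd, hQ,
    coeff_C_mul, sub_self]

/-- **WALL-STATE PENCIL LAW, α-STEP — the next in-wall slice (PROVED).**  Under the hypotheses of
`resForm_eq_pure_of_wall_pure_alpha` the in-wall slice of the next state (wall again on `u_a`) is pure with the SAME
root: `coeff_{r_{u+1}+m} F_{u+1} = U_u(0)·φ₀ · coeff_m (u_c − μ u_b)^s` for `|m| = s`, `m a = 0` — an α-step keeps the
pencil member (`ConeCut.restriction_of_plateau`). [new] [folklore] -/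
theorem wall_pure_succ_alpha (hroot : IsRoot q s₀) (W : ForcedWalk q s₀) (u : ℕ) {a b c : Fin 3}
    (hab : a ≠ b) (hac : a ≠ c) (hj : W.j u = a) {M s : ℕ}
    (hr : (W.st u).r = Finsupp.single a M) (hsh : (W.st u).shade = (s : ℕ∞))
    (hplat : (W.st (u + 1)).shade = (W.st u).shade) (hq : q < s + M) {φ₀ μ : K}
    (hwall : ∀ E : Fin 3 →₀ ℕ, E.degree = s → E a = 0 →
      coeff ((W.st u).r + E) (W.st u).F = φ₀ * coeff E ((X c - C μ * X b) ^ s))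
    (m : Fin 3 →₀ ℕ) (hma : m a = 0) (hm : m.degree = s) :
    coeff ((W.st (u + 1)).r + m) (W.st (u + 1)).F = (bUnit W u * φ₀) * coeff m ((X c - C μ * X b) ^ s) := by
  obtain ⟨ho, hres⟩ := resForm_eq_pure_of_wall_pure_alpha hroot W u hab hac hj hr hsh hplat hq hwall
  rw [restriction_of_plateau hroot W u ho (by exact_mod_cast hq) hplat hsh m (by rw [hj]; exact hma) hm, hres,
    coeff_C_mul, mul_assoc]

omit [DecidableEq K] in
/-- **Frame re-orientation of a pure power.**  `C φ · (u_c − κ u_a)^s = C (φ·(−κ)^s) · (u_a − κ⁻¹ u_c)^s` for `κ ≠ 0`: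
the in-wall root `κ` read in the frame `(·; a, c)` is the root `κ⁻¹` in the frame `(·; c, a)`, up to the unit
`(−κ)^s`. [folklore] -/
theorem pure_pow_reorient {a c : Fin 3} (φ κ : K) (hκ : κ ≠ 0) (s : ℕ) :
    (C φ * (X c - C κ * X a) ^ s : MvPolynomial (Fin 3) K) = C (φ * (-κ) ^ s) * (X a - C κ⁻¹ * X c) ^ s := by
  have h : (X c - C κ * X a : MvPolynomial (Fin 3) K) = C (-κ) * (X a - C κ⁻¹ * X c) := by
    have h1 : (C (-κ) * C κ⁻¹ : MvPolynomial (Fin 3) K) = -1 := by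
      rw [← C_mul, neg_mul, mul_inv_cancel₀ hκ, C_neg, C_1]
    rw [mul_sub, ← mul_assoc, h1, C_neg]
    ring
  rw [h, mul_pow, ← mul_assoc, ← C_pow, ← C_mul]

end WallAlphaStep

end Summit.ResolutionOfSingularities.ResolutionOfSingularities.Theorems.LossPolygon
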